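import Summits.QuantumFields.YangMills.Theorems.IR.AfPincerUcTypClusterReduced
import HarnessLib

/-!
# Crux `IR` (stmt-QuantumFields-19354), line `af-pincer-Uc`: the CLUSTER-COUNT class `TypCluster` is NESTED IN THE COUNT —
# walk compression (depth-first re-threading) and `TypCluster θ k ⊆ TypCluster θ k'` for `k ≤ k'` (seat ym-19354-afpincer-s1 g5)

Helper module for item `stmt-QuantumFields-19354` (`--supports stmt-QuantumFields-19354 --as helper`; it closes nothing; registry and
slot of record «sharp merge I♯_SC» sha16 `28967a1bf60ad397` UNTOUCHED).  Parts 1–3 (`AfPincerUcTypCluster{,Peierls,Reduced}`, p570237 ∕ p571139 ∕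
p572120) typed the count class `TypCluster ρ θ w k c` — no `θ`-bad WALK of `≤ 2k` steps through `k + 1` distinct own plaquettes — in WALK FORM,
which carries its own Peierls count but leaves the monotonicity in the count `k` non-obvious (a walk of `≤ 2k'` steps through `k' + 1 ≥ k + 1`
plaquettes need not have `≤ 2k` steps).  THIS FILE supplies the combinatorial lemma behind the docstrings' «≡ a `2`-step-connected family of
`≥ k + 1` bad plaquettes (depth-first traversal)» and the nestedness it yields:

* §1 **`exists_short_walk`** — WALK COMPRESSION for any symmetric adjacency on any type: a walk (`ℕ`-indexed, `n` adjacent steps) visiting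
  `≥ k + 1` distinct points contains, inside its visited set, a walk of `≤ 2k` steps visiting `≥ k + 1` distinct points.  (Induction on `k`: cut
  the walk just before its `(k+2)`-nd new point `v`, compress the prefix to `≤ 2k` steps through its `k + 1` points — which then include the
  predecessor `u` of `v` — and splice the detour `u → v → u` in: `+2` steps, `+1` point.)
* §2 **`HasBadClusterAmong.of_le`** (`k ≤ k'`: a bad cluster of more than `k'` plaquettes is one of more than `k`), **`typCluster_mono_count`**
  (`TypCluster ρ θ w k c ⊆ TypCluster ρ θ w k' c` for `k ≤ k'`), `typCluster_mono'` (monotone in `(θ, k)` jointly); consequences by name: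
  `clauseIAll_typCluster_anti_count` (clause (i) for a larger count implies it for a smaller one), `kernelPlaqSparseCluster_anti_count`
  (the named kernel sparseness with the count-`k'` guard implies the count-`k` one, `k ≤ k'`), `clauseIII_typCluster_mono_count`.

HONEST FRAMING: a combinatorial lemma and by-name monotonicity bookkeeping around ONE open stub of a CONDITIONAL chain (Track A 0/28 UV);
nothing of weak-coupling mixing, asymptotic freedom or a gap; not infinite volume, not Clay.  No `sorry`; axioms ⊆ {propext, Classical.choice,
Quot.sound}; no instances, no notation.
-/

set_option autoImplicit false

noncomputable section

open MeasureTheory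
open Literature.MathematicalPhysics.QuantumFieldTheory hiding ZdEdge
open Literature.MathematicalPhysics.QuantumLattice
open Summit.QuantumFields.YangMills.Theorems.OddTorusChessboard (cellPlaqs plaqAction)

namespace Summit.QuantumFields.YangMills.Cruxes.IR.AfPincerUc.SharpLanes

open Summit.QuantumFields.YangMills.Cruxes.IR.AfPincerUc

/-! ## §1 Walk compression -/
section Compression

/-- **Walk compression (PROVED).**  For a symmetric adjacency `adj` on `X`: every walk `c 0, …, c n` (`adj (c i) (c (i+1))` for `i < n`) visiting
at least `k + 1` distinct points admits a walk `w 0, …, w m` with `m ≤ 2k` adjacent steps, all of whose points are points of the original walk,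
visiting at least `k + 1` distinct points.  (Depth-first re-threading; induction on `k`.) -/
theorem exists_short_walk {X : Type*} [DecidableEq X] (adj : X → X → Prop) (hsymm : ∀ x y, adj x y → adj y x) :
    ∀ (k : ℕ) (c : ℕ → X) (n : ℕ), (∀ i < n, adj (c i) (c (i + 1))) →
      k + 1 ≤ ((Finset.range (n + 1)).image c).card →
        ∃ (w : ℕ → X) (m : ℕ), m ≤ 2 * k ∧ (∀ i < m, adj (w i) (w (i + 1))) ∧
          (∀ i ≤ m, w i ∈ (Finset.range (n + 1)).image c) ∧ k + 1 ≤ ((Finset.range (m + 1)).image w).card := by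
  intro k
  induction k with
  | zero =>
    intro c n _ _
    refine ⟨fun _ => c 0, 0, le_rfl, fun i hi => absurd hi (Nat.not_lt_zero i),
      fun i _ => Finset.mem_image_of_mem c (Finset.mem_range.2 (Nat.succ_pos n)), ?_⟩
    rw [zero_add, Nat.one_le_iff_ne_zero, Ne, Finset.card_eq_zero, Finset.image_eq_empty]
    exact Finset.nonempty_range_add_one.ne_empty
  | succ k ih =>
    intro c n hadj hcard
    -- prefix images
    have himg_succ : ∀ j : ℕ, (Finset.range (j + 1 + 1)).image c = insert (c (j + 1)) ((Finset.range (j + 1)).image c) := by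
      intro j
      rw [Finset.range_add_one, Finset.image_insert]
    have hP : ∃ j, k + 1 + 1 ≤ ((Finset.range (j + 1)).image c).card := ⟨n, hcard⟩
    have hfind := Nat.find_spec hP
    have hfind_le : Nat.find hP ≤ n := Nat.find_min' hP hcard
    have hpos : Nat.find hP ≠ 0 := by
      intro h0
      rw [h0] at hfind
      have : ((Finset.range (0 + 1)).image c).card ≤ 1 := Finset.card_image_le.trans (by simp)
      omega
    obtain ⟨j, hj⟩ := Nat.exists_eq_add_one_of_ne_zero hpos
    rw [hj] at hfind hfind_le
    have hlt : j < Nat.find hP := by omega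
    have hnot : ¬ (k + 1 + 1 ≤ ((Finset.range (j + 1)).image c).card) := Nat.find_min hP hlt
    have hle : ((Finset.range (j + 1 + 1)).image c).card ≤ ((Finset.range (j + 1)).image c).card + 1 := by
      rw [himg_succ]; exact Finset.card_insert_le _ _
    have hcj : k + 1 ≤ ((Finset.range (j + 1)).image c).card := by omega
    have hv : c (j + 1) ∉ (Finset.range (j + 1)).image c := by
      intro hmem
      rw [himg_succ, Finset.insert_eq_of_mem hmem] at hfind
      exact hnot hfind
    have hjn : j < n := by omega
    -- compress the prefix `c 0, …, c j`
    obtain ⟨w, m, hm, hwadj, hwmem, hwcard⟩ := ih c j (fun i hi => hadj i (by omega)) hcj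
    have hsub : (Finset.range (m + 1)).image w ⊆ (Finset.range (j + 1)).image c := by
      intro x hx
      obtain ⟨i, hi, rfl⟩ := Finset.mem_image.1 hx
      exact hwmem i (by have := Finset.mem_range.1 hi; omega)
    have heq : (Finset.range (m + 1)).image w = (Finset.range (j + 1)).image c :=
      Finset.eq_of_subset_of_card_le hsub (by omega)
    -- the predecessor `u = c j` of the new point `v = c (j+1)` is visited by the compressed prefix
    have hu : c j ∈ (Finset.range (m + 1)).image w := by
      rw [heq]; exact Finset.mem_image_of_mem c (Finset.mem_range.2 (Nat.lt_succ_self j))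
    obtain ⟨t, ht, htu⟩ := Finset.mem_image.1 hu
    have htm : t ≤ m := by have := Finset.mem_range.1 ht; omega
    -- splice the detour `u → v → u` in after position `t`
    let w' : ℕ → X := fun i => if i ≤ t then w i else if i = t + 1 then c (j + 1) else w (i - 2)
    have hw'_le : ∀ i, i ≤ t → w' i = w i := fun i hi => if_pos hi
    have hw'_v : w' (t + 1) = c (j + 1) := by
      show (if t + 1 ≤ t then w (t + 1) else if t + 1 = t + 1 then c (j + 1) else w (t + 1 - 2)) = c (j + 1)
      rw [if_neg (by omega), if_pos rfl]
    have hw'_ge : ∀ i, t + 2 ≤ i → w' i = w (i - 2) := by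
      intro i hi
      show (if i ≤ t then w i else if i = t + 1 then c (j + 1) else w (i - 2)) = w (i - 2)
      rw [if_neg (by omega), if_neg (by omega)]
    have hsubn : (Finset.range (j + 1)).image c ⊆ (Finset.range (n + 1)).image c :=
      Finset.image_subset_image (Finset.range_subset_range.2 (by omega))
    refine ⟨w', m + 2, by omega, fun i hi => ?_, fun i hi => ?_, ?_⟩
    · -- adjacency
      by_cases h1 : i + 1 ≤ t
      · rw [hw'_le i (by omega), hw'_le (i + 1) h1]
        exact hwadj i (by omega)
      by_cases h2 : i = t
      · subst h2
        rw [hw'_le i le_rfl, hw'_v, htu]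
        exact hadj j hjn
      by_cases h3 : i = t + 1
      · subst h3
        rw [hw'_v, hw'_ge (t + 1 + 1) (by omega), show t + 1 + 1 - 2 = t by omega, htu]
        exact hsymm _ _ (hadj j hjn)
      · rw [hw'_ge i (by omega), hw'_ge (i + 1) (by omega), show i + 1 - 2 = i - 2 + 1 by omega]
        exact hwadj (i - 2) (by omega)
    · -- the new walk's points are points of the original walk
      by_cases h1 : i ≤ t
      · rw [hw'_le i h1]; exact hsubn (hwmem i (by omega))
      by_cases h2 : i = t + 1
      · subst h2
        rw [hw'_v]
        exact Finset.mem_image_of_mem c (Finset.mem_range.2 (by omega))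
      · rw [hw'_ge i (by omega)]; exact hsubn (hwmem (i - 2) (by omega))
    · -- one more distinct point
      have hins : insert (c (j + 1)) ((Finset.range (m + 1)).image w) ⊆ (Finset.range (m + 2 + 1)).image w' := by
        intro x hx
        rcases Finset.mem_insert.1 hx with rfl | hx'
        · rw [← hw'_v]
          exact Finset.mem_image_of_mem w' (Finset.mem_range.2 (by omega))
        · obtain ⟨i, hi, rfl⟩ := Finset.mem_image.1 hx'
          have him : i ≤ m := by have := Finset.mem_range.1 hi; omega
          by_cases hit : i ≤ t
          · rw [← hw'_le i hit]
            exact Finset.mem_image_of_mem w' (Finset.mem_range.2 (by omega))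
          · rw [show w i = w' (i + 2) by rw [hw'_ge (i + 2) (by omega), show i + 2 - 2 = i by omega]]
            exact Finset.mem_image_of_mem w' (Finset.mem_range.2 (by omega))
      have hvw : c (j + 1) ∉ (Finset.range (m + 1)).image w := by rw [heq]; exact hv
      have := Finset.card_le_card hins
      rw [Finset.card_insert_of_notMem hvw] at this
      omega

end Compression

/-! ## §2 `TypCluster` is nested in the count -/
section Nested

variable {G : Type} [Group G] {N : ℕ} {ρ : G →* Matrix (Fin N) (Fin N) ℂ}

/-- **A bad cluster of more than `k'` plaquettes is a bad cluster of more than `k ≤ k'` plaquettes (PROVED)** — walk compression applied to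
the cluster walk, read back in `Fin`-indexed form. -/
theorem HasBadClusterAmong.of_le {θ : ℝ} {Pl : Set (ZdPlaquette 4)} {k k' : ℕ} (hkk' : k ≤ k') {U : LGConfig 4 G}
    (h : HasBadClusterAmong ρ θ Pl k' U) : HasBadClusterAmong ρ θ Pl k U := by
  classical
  obtain ⟨n, ch, -, hin, hbad, hstep, hcard⟩ := h
  -- `ℕ`-indexed copy of the walk
  let c : ℕ → ZdPlaquette 4 := fun i => if hi : i ≤ n then ch ⟨i, Nat.lt_succ_of_le hi⟩ else ch 0
  have hc : ∀ (i : ℕ) (hi : i ≤ n), c i = ch ⟨i, Nat.lt_succ_of_le hi⟩ := fun i hi => dif_pos hi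
  have hadj : ∀ i < n, supNormZ4 ((c i).1 - (c (i + 1)).1) ≤ 2 := by
    intro i hi
    rw [hc i hi.le, hc (i + 1) hi]
    exact hstep ⟨i, hi⟩
  have himg : Finset.univ.image ch ⊆ (Finset.range (n + 1)).image c := by
    intro p hp
    obtain ⟨i, -, rfl⟩ := Finset.mem_image.1 hp
    rw [show ch i = c i.val by rw [hc i.val (Nat.le_of_lt_succ i.isLt)]]
    exact Finset.mem_image_of_mem c (Finset.mem_range.2 i.isLt)
  have hcardc : k + 1 ≤ ((Finset.range (n + 1)).image c).card :=
    le_trans (by omega) ((hcard.trans (Finset.card_le_card himg)))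
  obtain ⟨w, m, hm, hwadj, hwmem, hwcard⟩ := exists_short_walk (fun p q : ZdPlaquette 4 => supNormZ4 (p.1 - q.1) ≤ 2)
    (fun p q hpq => by rw [supNormZ4_sub_comm]; exact hpq) k c n hadj hcardc
  -- every point of the compressed walk is a plaquette of the original walk
  have hpt : ∀ i ≤ m, ∃ i' : Fin (n + 1), w i = ch i' := by
    intro i hi
    obtain ⟨i', hi', he⟩ := Finset.mem_image.1 (hwmem i hi)
    have hi'n : i' ≤ n := by have := Finset.mem_range.1 hi'; omega
    exact ⟨⟨i', Nat.lt_succ_of_le hi'n⟩, by rw [← he, hc i' hi'n]⟩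
  refine ⟨m, fun i => w i.val, hm, fun i => ?_, fun i => ?_, fun i => hwadj i.val i.isLt, ?_⟩
  · obtain ⟨i', he⟩ := hpt i.val (Nat.le_of_lt_succ i.isLt)
    show w i.val ∈ Pl
    rw [he]; exact hin i'
  · obtain ⟨i', he⟩ := hpt i.val (Nat.le_of_lt_succ i.isLt)
    show θ ≤ plaqAction ρ (w i.val) U
    rw [he]; exact hbad i'
  · refine hwcard.trans (Finset.card_le_card fun p hp => ?_)
    obtain ⟨i, hi, rfl⟩ := Finset.mem_image.1 hp
    exact Finset.mem_image.2 ⟨⟨i, Finset.mem_range.1 hi⟩, Finset.mem_univ _, rfl⟩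

/-- **`TypCluster` is NESTED IN THE COUNT (PROVED)**: `k ≤ k'` gives `TypCluster ρ θ w k c ⊆ TypCluster ρ θ w k' c`. -/
theorem typCluster_mono_count {θ : ℝ} {w : Fin 4 → ℤ → ℤ} {k k' : ℕ} (hkk' : k ≤ k') {c : Fin 4 → ℤ} :
    TypCluster ρ θ w k c ⊆ TypCluster ρ θ w k' c :=
  fun _ hU h => hU (h.of_le hkk')

/-- `TypCluster` is monotone in `(θ, k)` jointly. -/
theorem typCluster_mono' {θ θ' : ℝ} {w : Fin 4 → ℤ → ℤ} {k k' : ℕ} {c : Fin 4 → ℤ} (hθ : θ ≤ θ') (hkk' : k ≤ k') :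
    TypCluster ρ θ w k c ⊆ TypCluster ρ θ' w k' c :=
  (typCluster_mono_count hkk').trans (typCluster_mono hθ)

variable [TopologicalSpace G] [IsTopologicalGroup G] [CompactSpace G] [MeasurableSpace G] [BorelSpace G]

/-- Clause (i) for a LARGER count implies clause (i) for a smaller one (antitone in the class, `clauseIAll_anti_typ`). -/
theorem clauseIAll_typCluster_anti_count {β : ℝ} {w : Fin 4 → ℤ → ℤ} {n : ℕ} {ε θ : ℝ} {k k' : ℕ} (hkk' : k ≤ k')
    (hI : ClauseIAll ρ β w n ε (TypCluster ρ θ w k')) : ClauseIAll ρ β w n ε (TypCluster ρ θ w k) :=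
  clauseIAll_anti_typ (fun _ => typCluster_mono_count hkk') hI

/-- The named kernel sparseness with the count-`k'` guard implies the one with the count-`k` guard, `k ≤ k'` (fewer admitted exteriors). -/
theorem kernelPlaqSparseCluster_anti_count {β : ℝ} {w : Fin 4 → ℤ → ℤ} {θ : ℝ} {k k' : ℕ} (hkk' : k ≤ k') {q : ℝ}
    (h : KernelPlaqSparseCluster ρ β w θ k' q) : KernelPlaqSparseCluster ρ β w θ k q :=
  fun F F' hFF' hF ζ hguard X hX =>
    h F F' hFF' hF ζ (fun c hc c' hc' => (hguard c hc c' hc').imp_right fun hζ => typCluster_mono_count hkk' hζ) X hX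

/-- Clause (iii) passes to every larger count and larger threshold (`clauseIII_of_subset`). -/
theorem clauseIII_typCluster_mono_count {β : ℝ} {w : Fin 4 → ℤ → ℤ} {b : ℕ} {δ θ θ' : ℝ} {k k' : ℕ} (hθ : θ ≤ θ') (hkk' : k ≤ k')
    (h : ClauseIII ρ β w b δ (TypCluster ρ θ w k)) : ClauseIII ρ β w b δ (TypCluster ρ θ' w k') :=
  clauseIII_of_subset (fun _ => typCluster_mono' hθ hkk') h

end Nested

end Summit.QuantumFields.YangMills.Cruxes.IR.AfPincerUc.SharpLanes

end
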